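import Literature.MathematicalPhysics.QuantumFieldTheory.Balaban1983to89.B7Eq170Flat

/-!
# `Balaban1983to89.B7Eq170General` — T. Bałaban, *Averaging operations for lattice gauge theories*, Commun. Math. Phys.
**98** (1985) 17–51 [Balaban1985Averaging], Sect. F (168)–(170) pp. 44–45: the product formula for averaged gauge
transformations `(R̄₀v)(y) = (R̄₀v₁)(y)(R̄₀v₂)(y)e^{ir̄(y)}`, `|r̄(y)| < c₁ + C₃(c₁ + c₂)²` AT A GENERAL (curved) BACKGROUND `V₀`
— kernel form with the explicit constant of `B7Eq170Flat`

statement-level skeleton of published theorems with citation tags; proofs where landed; nothing here is a claim about the Yang–Mills mass gap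

PDF held: `paper:balaban1985-cmp98-averaging` (journal page = PDF page + 16); renders `…/1985-cmp98-averaging-p028/p029-x2.png`.

CITATION HEADER (lean-in-tree rule).  lit-balaban SKELETON row `B7.Eq168` ((168)–(170); PHASE2 nomination of unit r04).
PRINT (p. 44, verbatim; the full passage is quoted in the module docstring of `B7Eq170Flat`): "we have functions v, v₁, v₂ defined
on a lattice Ω′ and a gauge field configuration V₀, and we assume that v(x) = v₁(x)v₂(x)e^{ir(x)}, |r(x)| < c₁,
|v_i⁻¹(y)(R_{0,y}v_i)(x) − 1| < c₂, i = 1, 2, x ∈ B(y), y ∈ Ω′^{(1)}. … v⁻¹(y)(R_{0,y}v)(x) =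
e^{−ir(y)}v₂⁻¹(y)v₁⁻¹(y)(R_{0,y}v₁)(x)·(R_{0,y}v₂)(x)e^{i(R_{0,y}r)(x)} = … (168)", (p. 45) "(R̄₀v)(y) = (R̄₀v₁)(y)(R̄₀v₂)(y)e^{ir̄(y)},
|r̄(y)| < c₁ + C₃(c₁ + c₂)², y ∈ Ω′^{(1)}. (170)".

WHAT THIS FILE PROVES.  `B7Eq170Flat.eq170_flat` kernel-checks (168)–(170) at the FLAT background `V₀ = 1` (its reading (a):
"The curved case needs `R_{0,y}` acting on both `v_i` and `r` and is NOT typed here").  This file supplies the curved case, for an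
ARBITRARY background `V₀ : ℤ^d → (Fin d → 𝔸ˣ)`, as a COROLLARY of the flat theorem: the twisted site average (78)
`B7Eq99Concrete.R0avg L V₀ v y` is BY DEFINITION the plain average `savg` of the rotated site function
`(R_{0,y}v)(x) = R(V₀(Γ_{y,x}))v(x)` (`B7Eq99Concrete.R0fun`), and the rotation `R(W)X = WXW⁻¹` ((56)–(57)) is an algebra
automorphism, so (first equality of (168), here `R0fun_vprod`)
`R_{0,y}(v₁v₂e^{ir}) = (R_{0,y}v₁)(R_{0,y}v₂)e^{iR_{0,y}r}` pointwise (`B7Eq92Concrete.Rc` is a monoid hom; `B7Eq92Concrete.expUnit_conj`),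
with `(R_{0,y}·)(y) = id` at the centre (`R0fun_self`).  Feeding the rotated data to `eq170_flat` gives **`eq170_general`**:
`(R̄₀v)(y) = (R̄₀v₁)(y)(R̄₀v₂)(y)e^{r̄(y)}`, `‖r̄(y)‖ ≤ c₁ + 31(2c₁ + 6c₂)²` (and **`eq170_general'`**, print's shape with the admissible
`C₃ = 1116` for `c₁, c₂ ≤ 1/400`), under the hypotheses IN PRINT'S OWN ROTATED FORM: `‖v_i⁻¹(y)(R_{0,y}v_i)(x) − 1‖ ≤ c₂` (verbatim
(166)/(180)-type), `‖(R_{0,y}r)(x)‖ ≤ c₁` (print: `|r(x)| < c₁` — for unitary `V₀` in a C⋆-algebra the rotation is an isometry, so the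
two agree: `norm_cj_of_mem_unitary`, `norm_R0lie_of_unitary`), and the near-isometry hypotheses `‖v₂(y)^{∓1} − 1‖ ≤ 2/5` of the flat
file (reading (c) there; instances of (166) in the application to Prop. 8).
NOT CLAIMED: Proposition 8 ((171)–(175), the induction along the levels with `V₀ = Ū₀ʲ`) — row `B7.Prop8`, nominated separately;
print's unstated value of `C₃`.  Unit `lit-balaban-r04` (gen 2), 2026-08-20.
-/

noncomputable section

open NormedSpace Finset

namespace Literature.MathematicalPhysics.QuantumFieldTheory.Balaban1983to89.B7Eq170General

open B7Prop1Explicit MatrixLog B7Eq92Concrete B7Eq99Concrete B7Eq170Flat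

export B7Prop1Explicit (Site)

variable {d : ℕ}

/-! ## §1 The rotation `R_{0,y}` on Lie-algebra-valued site functions and the first equality of (168) -/

section Rotation

variable {𝔸 : Type*} [NormedRing 𝔸]

/-- `(R_{0,y}r)(x) = R(V₀(Γ_{y,x}))r(x)` — the rotation of p. 27 (display after (59)) applied to an ALGEBRA-valued site function
`r` (print p. 44: "`e^{i(R_{0,y}r)(x)}`"), `Γ_{y,x}` = the tree contour `treeWord (x − y)` from `y`, `R(W)X = WXW⁻¹`
(`B7Eq170Flat.cj`). [cite: Balaban1985Averaging, (168) p.44] -/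
def R0lie (V₀ : Site d → Fin d → 𝔸ˣ) (y : Site d) (r : Site d → 𝔸) : Site d → 𝔸 :=
  fun x => cj (hol V₀ y (treeWord (x - y))) (r x)

/-- `R0lie_apply`: unfolding. [cite: Balaban1985Averaging, (168) p.44] -/
@[simp] theorem R0lie_apply (V₀ : Site d → Fin d → 𝔸ˣ) (y : Site d) (r : Site d → 𝔸) (x : Site d) :
    R0lie V₀ y r x = cj (hol V₀ y (treeWord (x - y))) (r x) := rfl

/-- At the centre the rotation is trivial: `(R_{0,y}r)(y) = r(y)` (`Γ_{y,y}` is the empty contour).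
[cite: Balaban1985Averaging, (168) p.44] -/
@[simp] theorem R0lie_self (V₀ : Site d → Fin d → 𝔸ˣ) (y : Site d) (r : Site d → 𝔸) : R0lie V₀ y r y = r y := by
  simp [R0lie, cj_apply]

/-- At `V₀ = 1` there is no rotation: `(R_{0,y}r)(x) = r(x)`. [cite: Balaban1985Averaging, (168) p.44] -/
@[simp] theorem R0lie_one_left (y : Site d) (r : Site d → 𝔸) : R0lie (1 : Site d → Fin d → 𝔸ˣ) y r = r := by
  funext x
  simp [R0lie, cj, B8Ineq130.hol_one]

/-- **(168), first equality, at a general background** — pointwise multiplicativity of the rotation: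
`R_{0,y}(v₁v₂e^{ir})(x) = (R_{0,y}v₁)(x)·(R_{0,y}v₂)(x)·e^{i(R_{0,y}r)(x)}` (print: "v⁻¹(y)(R_{0,y}v)(x) =
e^{−ir(y)}v₂⁻¹(y)v₁⁻¹(y)(R_{0,y}v₁)(x)·(R_{0,y}v₂)(x)e^{i(R_{0,y}r)(x)}", which is this identity multiplied by `v⁻¹(y)`), because
`R(W)` is a group automorphism ((57), `B7Eq92Concrete.Rc`) and `R(W)e^{X} = e^{R(W)X}` (`B7Eq92Concrete.expUnit_conj`).
[cite: Balaban1985Averaging, (168) p.44] -/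
theorem R0fun_vprod [NormedAlgebra ℂ 𝔸] [CompleteSpace 𝔸] (V₀ : Site d → Fin d → 𝔸ˣ) (y : Site d) (v₁ v₂ : Site d → 𝔸ˣ) (r : Site d → 𝔸) :
    R0fun V₀ y (vprod v₁ v₂ r) = vprod (R0fun V₀ y v₁) (R0fun V₀ y v₂) (R0lie V₀ y r) := by
  funext x
  simp only [R0fun_apply, vprod_apply, map_mul, R0lie_apply, cj_apply]
  rw [expUnit_conj]

end Rotation

/-! ## §2 (169)–(170) at a general background -/

section Eq170

variable {𝔸 : Type*} [NormedRing 𝔸] [NormedAlgebra ℂ 𝔸] [CompleteSpace 𝔸]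

/-- **`r̄(y)` of (169)–(170) at the background `V₀`**: `ir̄(y) := log [((R̄₀v₁)(y)(R̄₀v₂)(y))⁻¹(R̄₀v)(y)]` with the TWISTED site
averages (78) `R̄₀ = B7Eq99Concrete.R0avg L V₀` — by `R0avg L V₀ v y = savg L (R0fun V₀ y v) y` this is `B7Eq170Flat.rbar` of the
rotated data. [cite: Balaban1985Averaging, (169)–(170) pp.44–45] -/
def rbarGen (L : ℕ) (V₀ : Site d → Fin d → 𝔸ˣ) (v₁ v₂ : Site d → 𝔸ˣ) (r : Site d → 𝔸) (y : Site d) : 𝔸 :=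
  rbar L (R0fun V₀ y v₁) (R0fun V₀ y v₂) (R0lie V₀ y r) y

/-- `rbarGen` at `V₀ = 1` is the flat `rbar`. [cite: Balaban1985Averaging, (169)–(170) pp.44–45] -/
theorem rbarGen_one_left (L : ℕ) (v₁ v₂ : Site d → 𝔸ˣ) (r : Site d → 𝔸) (y : Site d) :
    rbarGen L (1 : Site d → Fin d → 𝔸ˣ) v₁ v₂ r y = rbar L v₁ v₂ r y := by
  simp [rbarGen]

variable {L : ℕ} {V₀ : Site d → Fin d → 𝔸ˣ} {v₁ v₂ : Site d → 𝔸ˣ} {r : Site d → 𝔸} {y : Site d} {c₁ c₂ : ℝ}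

/-- **(169)–(170) AT A GENERAL BACKGROUND `V₀`, kernel form with an explicit constant.**  For site functions
`v₁, v₂ : ℤ^d → 𝔸ˣ`, `r : ℤ^d → 𝔸`, `v = v₁v₂e^{r}` (`B7Eq170Flat.vprod`), a background `V₀`, a block corner `y`, `L ≥ 1`, under
print's hypotheses in their rotated form — `‖r(y)‖ ≤ c₁`, `‖(R_{0,y}r)(x)‖ ≤ c₁` and `‖v_i⁻¹(y)(R_{0,y}v_i)(x) − 1‖ ≤ c₂` for
`x = y + ρ ∈ B(y)`, `i = 1, 2` — plus the near-isometry hypotheses `‖v₂(y)^{∓1} − 1‖ ≤ 2/5` and the smallness `2c₁ + 6c₂ ≤ 1/45`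
of the flat theorem: `(R̄₀v)(y) = (R̄₀v₁)(y)·(R̄₀v₂)(y)·e^{r̄(y)}` and `‖r̄(y)‖ ≤ c₁ + 31(2c₁ + 6c₂)²`, where `R̄₀ = R0avg L V₀` is the
twisted site average (78).  Print (170): "(R̄₀v)(y) = (R̄₀v₁)(y)(R̄₀v₂)(y)e^{ir̄(y)}, |r̄(y)| < c₁ + C₃(c₁ + c₂)², y ∈ Ω′^{(1)}".
Proof: `B7Eq170Flat.eq170_flat` for the rotated data, via `R0fun_vprod` and `R0fun_self`. [cite: Balaban1985Averaging, (169)–(170) pp.44–45] -/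
theorem eq170_general
    (hRy : ‖r y‖ ≤ c₁) (hR : ∀ ρ : Fin d → Fin L, ‖R0lie V₀ y r (y + boxVec L ρ)‖ ≤ c₁)
    (hA₁ : ∀ ρ : Fin d → Fin L, ‖((((v₁ y)⁻¹ * R0fun V₀ y v₁ (y + boxVec L ρ) : 𝔸ˣ)) : 𝔸) - 1‖ ≤ c₂)
    (hA₂ : ∀ ρ : Fin d → Fin L, ‖((((v₂ y)⁻¹ * R0fun V₀ y v₂ (y + boxVec L ρ) : 𝔸ˣ)) : 𝔸) - 1‖ ≤ c₂)
    (hw : ‖((((v₂ y)⁻¹ : 𝔸ˣ)) : 𝔸) - 1‖ ≤ 2 / 5) (hw' : ‖((v₂ y : 𝔸ˣ) : 𝔸) - 1‖ ≤ 2 / 5)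
    (hL : 1 ≤ L) (hs : 2 * c₁ + 6 * c₂ ≤ 1 / 45) :
    R0avg L V₀ (vprod v₁ v₂ r) y = R0avg L V₀ v₁ y * R0avg L V₀ v₂ y * expUnit (rbarGen L V₀ v₁ v₂ r y) ∧
      ‖rbarGen L V₀ v₁ v₂ r y‖ ≤ c₁ + 31 * (2 * c₁ + 6 * c₂) ^ 2 := by
  have hRy' : ‖R0lie V₀ y r y‖ ≤ c₁ := by rwa [R0lie_self]
  have hA₁' : ∀ ρ : Fin d → Fin L,
      ‖((((R0fun V₀ y v₁ y)⁻¹ * R0fun V₀ y v₁ (y + boxVec L ρ) : 𝔸ˣ)) : 𝔸) - 1‖ ≤ c₂ := by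
    intro ρ; rw [R0fun_self]; exact hA₁ ρ
  have hA₂' : ∀ ρ : Fin d → Fin L,
      ‖((((R0fun V₀ y v₂ y)⁻¹ * R0fun V₀ y v₂ (y + boxVec L ρ) : 𝔸ˣ)) : 𝔸) - 1‖ ≤ c₂ := by
    intro ρ; rw [R0fun_self]; exact hA₂ ρ
  have hw₁ : ‖((((R0fun V₀ y v₂ y)⁻¹ : 𝔸ˣ)) : 𝔸) - 1‖ ≤ 2 / 5 := by rw [R0fun_self]; exact hw
  have hw₂ : ‖((R0fun V₀ y v₂ y : 𝔸ˣ) : 𝔸) - 1‖ ≤ 2 / 5 := by rw [R0fun_self]; exact hw'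
  have h := eq170_flat hRy' hR hA₁' hA₂' hw₁ hw₂ hL hs
  rw [R0avg, R0avg, R0avg, R0fun_vprod, rbarGen]
  exact h

/-- **(170) at a general background in print's shape** `|r̄(y)| < c₁ + C₃(c₁ + c₂)²` with the explicit admissible constant
`C₃ = 1116`, for `c₁, c₂ ≤ 1/400` (same constant as `B7Eq170Flat.eq170_flat'`). [cite: Balaban1985Averaging, (170) p.45] -/
theorem eq170_general'
    (hRy : ‖r y‖ ≤ c₁) (hR : ∀ ρ : Fin d → Fin L, ‖R0lie V₀ y r (y + boxVec L ρ)‖ ≤ c₁)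
    (hA₁ : ∀ ρ : Fin d → Fin L, ‖((((v₁ y)⁻¹ * R0fun V₀ y v₁ (y + boxVec L ρ) : 𝔸ˣ)) : 𝔸) - 1‖ ≤ c₂)
    (hA₂ : ∀ ρ : Fin d → Fin L, ‖((((v₂ y)⁻¹ * R0fun V₀ y v₂ (y + boxVec L ρ) : 𝔸ˣ)) : 𝔸) - 1‖ ≤ c₂)
    (hw : ‖((((v₂ y)⁻¹ : 𝔸ˣ)) : 𝔸) - 1‖ ≤ 2 / 5) (hw' : ‖((v₂ y : 𝔸ˣ) : 𝔸) - 1‖ ≤ 2 / 5)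
    (hL : 1 ≤ L) (hc₁ : c₁ ≤ 1 / 400) (hc₂ : c₂ ≤ 1 / 400) :
    R0avg L V₀ (vprod v₁ v₂ r) y = R0avg L V₀ v₁ y * R0avg L V₀ v₂ y * expUnit (rbarGen L V₀ v₁ v₂ r y) ∧
      ‖rbarGen L V₀ v₁ v₂ r y‖ ≤ c₁ + 1116 * (c₁ + c₂) ^ 2 := by
  have hc₁0 : 0 ≤ c₁ := (norm_nonneg _).trans hRy
  have hc₂0 : 0 ≤ c₂ := (norm_nonneg _).trans (hA₂ fun _ => ⟨0, hL⟩)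
  obtain ⟨h1, h2⟩ := eq170_general hRy hR hA₁ hA₂ hw hw' hL (by linarith)
  refine ⟨h1, h2.trans ?_⟩
  have hsq : (2 * c₁ + 6 * c₂) ^ 2 ≤ 36 * (c₁ + c₂) ^ 2 := by nlinarith
  linarith

end Eq170

/-! ## §3 Why the rotated hypotheses are print's: for a unitary background the rotation is an isometry -/

section Unitary

variable {𝔸 : Type*} [NormedRing 𝔸] [StarRing 𝔸] [CStarRing 𝔸]

omit [CStarRing 𝔸] in
/-- For a unit `W` whose value is unitary, `W⁻¹ = W*`. [folklore] -/
private theorem val_inv_eq_star_of_mem_unitary {W : 𝔸ˣ} (hW : (W : 𝔸) ∈ unitary 𝔸) :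
    ((W⁻¹ : 𝔸ˣ) : 𝔸) = star (W : 𝔸) := by
  have h1 : (W : 𝔸) * star (W : 𝔸) = 1 := Unitary.mul_star_self_of_mem hW
  calc ((W⁻¹ : 𝔸ˣ) : 𝔸) = ((W⁻¹ : 𝔸ˣ) : 𝔸) * ((W : 𝔸) * star (W : 𝔸)) := by rw [h1, mul_one]
    _ = star (W : 𝔸) := by rw [← mul_assoc, Units.inv_mul, one_mul]

/-- In a C⋆-algebra, conjugation by a unitary is an isometry: `‖WXW⁻¹‖ = ‖X‖` for `W` unitary (print, p. 44, uses
`|R(v₂⁻¹(y))X| = |X|` and `|(R_{0,y}r)(x)| = |r(x)|` silently: `G ⊂ U(N)`). [cite: Balaban1985Averaging, (168) p.44] -/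
theorem norm_cj_of_mem_unitary {W : 𝔸ˣ} (hW : (W : 𝔸) ∈ unitary 𝔸) (X : 𝔸) : ‖cj W X‖ = ‖X‖ := by
  rw [cj_apply, val_inv_eq_star_of_mem_unitary hW, mul_assoc, CStarRing.norm_mem_unitary_mul (X * star (W : 𝔸)) hW,
    CStarRing.norm_mul_mem_unitary X (Unitary.star_mem hW)]

omit [CStarRing 𝔸] in
/-- Every bond step of a unitary-valued configuration is unitary. [folklore] -/
private theorem stepHol_mem_unitary {V₀ : Site d → Fin d → 𝔸ˣ} (hV : ∀ x κ, ((V₀ x κ : 𝔸ˣ) : 𝔸) ∈ unitary 𝔸)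
    (x : Site d) (l : Letter d) : ((stepHol V₀ x l : 𝔸ˣ) : 𝔸) ∈ unitary 𝔸 := by
  unfold stepHol
  split_ifs
  · exact hV _ _
  · rw [val_inv_eq_star_of_mem_unitary (hV _ _)]; exact Unitary.star_mem (hV _ _)

omit [CStarRing 𝔸] in
/-- Every holonomy (9) of a unitary-valued configuration is unitary. [cite: Balaban1985Averaging, (9) p.18] -/
theorem hol_mem_unitary {V₀ : Site d → Fin d → 𝔸ˣ} (hV : ∀ x κ, ((V₀ x κ : 𝔸ˣ) : 𝔸) ∈ unitary 𝔸) :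
    ∀ (z : Site d) (w : List (Letter d)), ((hol V₀ z w : 𝔸ˣ) : 𝔸) ∈ unitary 𝔸
  | z, [] => by rw [hol_nil, Units.val_one]; exact Submonoid.one_mem _
  | z, l :: w => by
    rw [hol_cons, Units.val_mul]
    exact Submonoid.mul_mem _ (stepHol_mem_unitary hV z l) (hol_mem_unitary hV _ w)

end Unitary

section UnitaryBackground

variable {𝔸 : Type*} [NormedRing 𝔸] [StarRing 𝔸] [CStarRing 𝔸]

/-- Hence for a UNITARY-valued background `V₀` the hypothesis `‖(R_{0,y}r)(x)‖ ≤ c₁` of `eq170_general` is exactly print's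
`|r(x)| < c₁` (`≤` typed): the transporter `V₀(Γ_{y,x})`, a product of unitaries, is unitary. [cite: Balaban1985Averaging, (168) p.44] -/
theorem norm_R0lie_of_unitary (V₀ : Site d → Fin d → 𝔸ˣ) (hV : ∀ x κ, ((V₀ x κ : 𝔸ˣ) : 𝔸) ∈ unitary 𝔸)
    (y : Site d) (r : Site d → 𝔸) (x : Site d) : ‖R0lie V₀ y r x‖ = ‖r x‖ := by
  rw [R0lie_apply]
  exact norm_cj_of_mem_unitary (hol_mem_unitary hV y _) (r x)

end UnitaryBackground

end Literature.MathematicalPhysics.QuantumFieldTheory.Balaban1983to89.B7Eq170General
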